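import Summits.BirchSwinnertonDyer.Rank1Residual.P2.KrizLiSmallCMBase
import HarnessLib

/-!
# Cell `bsd-print-cf2` (D-0131 (2) PRINT TIER, leaf CornerF @ `p = 2`), prover p3 «cube sums» — the cube-sum
# curve `x³ + y³ = 9` (`243a1`) through the Kriz–Li door over ANY Heegner field, the (★)-datum DISPLAYED

HONEST FRAMING. The leaf `Summit.BirchSwinnertonDyer.WAllCornerFTwo` and crux `InertJZeroOfFacts` (20671) are
OPEN AS CLASSES; nothing class-wide is closed here; no named fact is introduced; nothing is asserted. p3 g2's
files `P2/KrizLiTwoFortyThree{Curve,Slices,IsogenyClass}.lean` close the PRINTED instance `(243a1, ℚ(√−23))`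
of Kriz–Li 2019 Thm 5.1 (2) (the Table-1 row). The theorem is stated for ANY imaginary quadratic `K` with the
Heegner hypothesis and `2` split; for `E = 243a1 = x³ + y³ = 9` (`N = 3⁵`) that is ANY `K` with `(d_K/3) = 1`
and `d_K ≡ 1 (mod 8)`, and EVERY such `K` at which (★) holds gives a NEW family (new primes `ℓ` — those split
in `K` with `a_ℓ` odd — and new rank-zero partners `243a1^{(d·d_K)}`). This file is that `K`-generic fibre,
an instance of the generic door `P2/KrizLiSmallCMBase{Transport,}.lean`: granted the seven named facts `hKL h33
hS31 hBF hmod hGZK hCassels` and a DISPLAYED (★)-datum `hSD : P2.HasKrizLiStarDatum curve243a1 K`, `BSD(W', 2)`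
for every globally minimal `W'` `ℚ`-isogenous to `243a1^{(d)}` or `243a1^{(d·d_K)}`, `d ∈ 𝒩(243a1, K)`,
`χ_d(−N) = 1`. The datum is PRINTED for `d_K = −23` only (Table 1; `hasKrizLiStarDatum_curve243a1`); for
`d_K ∈ {−71, −95, −143, −215, −239, −263, −335, −431, −479, −527, −647, −671, −719, −743, −767}` it is an EXACT
CERTIFICATE (lit g5, kit j286962: rational Heegner trace `P_K = ±P₀ + t`, odd Heegner index, `v₂(3·log_ω P_K) = 1`;
e.g. `d_K = −71`: `P_K = (1, 0) = P₀`), currency LITERAL-by-name((★)-display); (★) FAILS (even index) at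
`d_K ∈ {−119, −167, −191, −359, −383, −407, −455, −551, −623, −695, −791}` and the trace is torsion
(`r_an(243a1^{(d_K)}) = 2`) at `{−47, −287, −311, −503, −599}` (|d_K| ≤ 800).

Beyond print: NO as a method; as coverage, fifteen further infinite quadratic-twist families of the cube-sum curve
`x³ + y³ = 9`, each by one theorem call on a certificate. The cubic-twist family `{x³ + y³ = n}` stays OPEN at `2`.

References: [KrizLi2019] Thm 5.1 (2), Thm 4.3, Def 4.1, §6 Ex. 6.2, Table 1 (row 243a1), Rem 6.3; [CreutzMiller2012]
Thm 1.1; [BurungaleFlach2024] Thm 1.1, Cor 2; [MilneADT2006] I.7.3; [Marcus1977] Ch. 3 Thm 25; [DasguptaVoight2018]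
§1 (`E₉ = 243a1`); lit DOSSIER §14.6, STATUS 2026-08-27T18:37Z (lit g5 certificate table).
-/

noncomputable section

open scoped Classical

open WeierstrassCurve NumberField Literature.NumberTheory.EllipticCurves
  Literature.NumberTheory.EllipticCurves.Rank1Residual
  Literature.NumberTheory.EllipticCurves.ModularForms
  Summit.BirchSwinnertonDyer.Rank1Residual

set_option autoImplicit false

namespace Summit.BirchSwinnertonDyer.Rank1Residual.P2

/-! ## §1 Heegner fields of `243a1`: any quadratic `K` with `(d_K/3) = 1` -/

/-- **The Heegner hypothesis for `(243a1, K)` from ONE Kronecker symbol**: `N(E) ∣ 3⁵`, so every prime of `N(E)`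
splits in the quadratic field `K` as soon as `(d_K/3) = 1`. [cite: KrizLi2019, Thm. 5.1 hypothesis "Heegner hypothesis for N"]
[cite: Marcus1977, Ch. 3 Thm. 25] -/
theorem satisfiesHeegnerHypothesis_curve243a1_of_jacobiSym {K : Type} [Field K] [NumberField K]
    (h2 : Module.finrank ℚ K = 2) (h3 : jacobiSym (NumberField.discr K) 3 = 1) :
    SatisfiesHeegnerHypothesis (curve243a1.conductorNorm ℤ) K := by
  have h243 : SatisfiesHeegnerHypothesis (3 ^ 5) K := by
    rw [satisfiesHeegnerHypothesis_iff_kronecker _ K h2]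
    intro q hq hqN
    obtain rfl := (Nat.prime_dvd_prime_iff_eq hq Nat.prime_three).mp (hq.dvd_of_dvd_pow hqN)
    exact ⟨fun h => absurd h (by norm_num), fun _ => h3⟩
  exact h243.of_dvd (by simpa using conductorNorm_curve243a1_dvd)

/-- **An EXPLICIT sufficient condition for `ℓ ∈ 𝒮(243a1, K)`** for a quadratic `K` of discriminant `D`: `ℓ` prime,
`ℓ ∉ {2, 3}`, `(D/ℓ) = 1` (`ℓ` splits in `K`) and `a_ℓ(243a1)` odd. [cite: KrizLi2019, Def. 4.1 (FMS) = arXiv Def. 3.1] -/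
def IsKrizLiPrime243In (D : ℤ) (ℓ : ℕ) : Prop :=
  ℓ.Prime ∧ ℓ ≠ 2 ∧ ℓ ≠ 3 ∧ jacobiSym D ℓ = 1 ∧ Odd (curve243a1.frobeniusTrace ℓ)

/-- **`ℓ ∈ 𝒮(243a1, K)`** for such `ℓ`, in any quadratic `K` with `d_K = D`. [cite: KrizLi2019, Def. 4.1 (FMS)] -/
theorem inS_curve243a1_of_discr {K : Type} [Field K] [NumberField K] (h2 : Module.finrank ℚ K = 2) {D : ℤ}
    (hdK : NumberField.discr K = D) {ℓ : ℕ} (h : IsKrizLiPrime243In D ℓ) : KrizLi2019.InS curve243a1 K ℓ := by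
  refine ⟨h.1, not_dvd_two_mul_conductorNorm_curve243a1 h.1 h.2.1 h.2.2.1, ?_, h.2.2.2.2⟩
  rw [Literature.NumberTheory.QuadraticFields.Quadratic.ncard_primesOver_eq_two_iff_jacobiSym h2 h.1 h.2.1, hdK]
  exact h.2.2.2.1

/-- **`d ∈ 𝒩(243a1, K)`** from the explicit conditions, in any quadratic `K` with `d_K = D`. [cite: KrizLi2019, Def. 4.1 (FMS)] -/
theorem inN_curve243a1_of_discr {K : Type} [Field K] [NumberField K] (h2 : Module.finrank ℚ K = 2) {D : ℤ}
    (hdK : NumberField.discr K = D) {d : ℤ} (hd4 : d % 4 = 1) (hsq : Squarefree d.natAbs)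
    (hprimes : ∀ ℓ : ℕ, ℓ.Prime → ℓ ∣ d.natAbs → IsKrizLiPrime243In D ℓ) : KrizLi2019.InN curve243a1 K d :=
  ⟨hd4, hsq, fun ℓ hℓ hℓd => inS_curve243a1_of_discr h2 hdK (hprimes ℓ hℓ hℓd)⟩

/-! ## §2 The `K`-generic slice of the cube-sum curve `x³ + y³ = 9`, (★) displayed -/

/-- **`BSD(W', 2)` on the Kriz–Li family of `243a1 = x³ + y³ = 9` over ANY Heegner field `K`** (imaginary quadratic,
`(d_K/3) = 1`) carrying a DISPLAYED (★)-datum `hSD : HasKrizLiStarDatum curve243a1 K` (it contains "`2` splits in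
`K`"): for `d ∈ 𝒩(243a1, K)` with `χ_d(−N) = 1` and every globally minimal `W'` `ℚ`-isogenous to `243a1^{(d)}` or
`243a1^{(d·d_K)}` — granted BY NAME Kriz–Li Thm 5.1 (2) (`hKL`), Thm 4.3 (`h33`), Creutz–Miller (`hS31`),
Burungale–Flach (`hBF`), modularity (`hmod`), GZK (`hGZK`), Cassels (`hCassels`). For `d_K = −23` the datum is
the printed row (`hasKrizLiStarDatum_curve243a1`) and this is p3 g2's theorem; for the fifteen further certified
`d_K` (module docstring) it is a certificate. [cite: KrizLi2019, Thm. 5.1 (2) (FMS, VoR p. 30), Thm. 4.3, §6 Table 1]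
[cite: CreutzMiller2012, Thm. 1.1] [cite: BurungaleFlach2024, Thm. 1.1 and Cor. 2] [cite: MilneADT2006, Thm. I.7.3] -/
theorem bsdp_two_of_isIsogenous_twist_curve243a1_of_field (hKL : KrizLi2019.thm112_bsdTwo_twist)
    (h33 : KrizLi2019.thm33_rank_twist) (hS31 : bsdTriple_of_analyticRank_le_one_of_conductor_lt)
    (hBF : bsdTriple_of_hasCM_of_L_one_ne_zero) (hmod : hasEntireLFunction_rat)
    (hGZK : rank_eq_analyticRank_of_analyticRank_le_one) (hCassels : bsdRHS_eq_of_isIsogenous)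
    (K : Type) [Field K] [NumberField K] (hK : IsImaginaryQuadratic K) (h3 : jacobiSym (NumberField.discr K) 3 = 1)
    (hSD : HasKrizLiStarDatum curve243a1 K)
    {d : ℤ} (hd : KrizLi2019.InN curve243a1 K d)
    (hsign : Int.sign d * jacobiSym (curve243a1.conductorNorm ℤ) d.natAbs = 1)
    (W' : WeierstrassCurve ℚ) [W'.IsElliptic] [W'.IsGloballyMinimal]
    (hiso : IsIsogenous W' (curve243a1.quadraticTwist (d : ℚ)) ∨
      IsIsogenous W' (curve243a1.quadraticTwist ((d * NumberField.discr K : ℤ) : ℚ))) : BSDp W' 2 :=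
  haveI : Fact (2 : ℕ).Prime := ⟨Nat.prime_two⟩
  bsdp_two_of_isIsogenous_twist_of_hasKrizLiStarDatum curve243a1 hKL h33 hS31 hBF hmod hGZK hCassels
    hasCM_curve243a1 (lt_of_le_of_lt (Nat.le_of_dvd (by norm_num) conductorNorm_curve243a1_dvd) (by norm_num))
    one_le_mordellWeilRank_curve243a1 twoTorsion_curve243a1
    (by rw [localTamagawaNumber_two_curve243a1]; exact odd_one) K hK
    (satisfiesHeegnerHypothesis_curve243a1_of_jacobiSym hK.1 h3) hSD hd hsign W' hiso

/-- **The analytic ranks along the `K`-family**: `r_an = 1` on the minimal models of `243a1^{(d)}`, `0` on those of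
`243a1^{(d·d_K)}`. [cite: KrizLi2019, Thm. 4.3 (FMS) = arXiv Thm. 3.3] -/
theorem analyticRank_of_twist_curve243a1_of_field (h33 : KrizLi2019.thm33_rank_twist)
    (hBF : bsdTriple_of_hasCM_of_L_one_ne_zero) (hmod : hasEntireLFunction_rat)
    (K : Type) [Field K] [NumberField K] (hK : IsImaginaryQuadratic K) (h3 : jacobiSym (NumberField.discr K) 3 = 1)
    (hSD : HasKrizLiStarDatum curve243a1 K)
    {d : ℤ} (hd : KrizLi2019.InN curve243a1 K d)
    (hsign : Int.sign d * jacobiSym (curve243a1.conductorNorm ℤ) d.natAbs = 1)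
    (W₁ W₂ : WeierstrassCurve ℚ) [W₁.IsElliptic] [W₁.IsGloballyMinimal] [W₂.IsElliptic] [W₂.IsGloballyMinimal]
    (hW₁ : ∃ C : VariableChange ℚ, C • curve243a1.quadraticTwist (d : ℚ) = W₁)
    (hW₂ : ∃ C : VariableChange ℚ, C • curve243a1.quadraticTwist ((d * NumberField.discr K : ℤ) : ℚ) = W₂) :
    W₁.analyticRank = 1 ∧ W₂.analyticRank = 0 :=
  analyticRank_of_twist_of_hasKrizLiStarDatum curve243a1 h33 hBF hmod hasCM_curve243a1
    one_le_mordellWeilRank_curve243a1 twoTorsion_curve243a1 K hK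
    (satisfiesHeegnerHypothesis_curve243a1_of_jacobiSym hK.1 h3) hSD hd hsign W₁ W₂ hW₁ hW₂

/-! ## §3 Membership predicate of the `K`-fibre and the slice in leaf shape -/

/-- **`W'` is `ℚ`-ISOGENOUS to a Kriz–Li twist of `243a1` OVER THE FIELD `K`**: `d ∈ 𝒩(243a1, K)` with `χ_d(−N) = 1`
and `W' ~ 243a1^{(d)}` or `W' ~ 243a1^{(d·d_K)}`. No (★) inside; a definition with a body (data `d`).
For `K = sqrtField (−23)` it is p3 g2's `IsIsogenousToKrizLiTwoFortyThreeTwist` up to `d·d_K = −23·d`.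
[cite: KrizLi2019, Def. 4.1 and Thm. 5.1 (2)] -/
def IsIsogenousToKrizLiTwoFortyThreeTwistIn (K : Type) [Field K] [NumberField K] (W' : WeierstrassCurve ℚ) : Prop :=
  ∃ d : ℤ, KrizLi2019.InN curve243a1 K d ∧ Int.sign d * jacobiSym (curve243a1.conductorNorm ℤ) d.natAbs = 1 ∧
    (IsIsogenous W' (curve243a1.quadraticTwist (d : ℚ)) ∨
      IsIsogenous W' (curve243a1.quadraticTwist ((d * NumberField.discr K : ℤ) : ℚ)))

/-- **Granted the (★)-display over `K`, the `K`-fibre lies in the generic family** (`IsIsogenousToKrizLiTwistOfSmallCMBase`,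
the membership of aside 21366's road). [cite: KrizLi2019, Thm. 5.1 (2) (hypothesis list)] -/
theorem isIsogenousToKrizLiTwistOfSmallCMBase_of_twoFortyThreeIn (K : Type) [Field K] [NumberField K]
    (hK : IsImaginaryQuadratic K) (h3 : jacobiSym (NumberField.discr K) 3 = 1) (hSD : HasKrizLiStarDatum curve243a1 K)
    {W' : WeierstrassCurve ℚ} (hW' : IsIsogenousToKrizLiTwoFortyThreeTwistIn K W') :
    IsIsogenousToKrizLiTwistOfSmallCMBase W' := by
  haveI : Fact (2 : ℕ).Prime := ⟨Nat.prime_two⟩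
  obtain ⟨d, hd, hsign, hiso⟩ := hW'
  exact ⟨curve243a1, inferInstance, inferInstance, inferInstance, hasCM_curve243a1,
    lt_of_le_of_lt (Nat.le_of_dvd (by norm_num) conductorNorm_curve243a1_dvd) (by norm_num),
    one_le_mordellWeilRank_curve243a1, twoTorsion_curve243a1,
    (by rw [localTamagawaNumber_two_curve243a1]; exact odd_one), K, inferInstance, inferInstance, hK,
    satisfiesHeegnerHypothesis_curve243a1_of_jacobiSym hK.1 h3, hSD, d, hd, hsign, hiso⟩

/-- **SLICE BY NAME in LEAF SHAPE over the field `K`, (★) DISPLAYED.** Currency LITERAL-by-name((★)-display) off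
`d_K = −23`. [cite: KrizLi2019, Thm. 5.1 (2), Thm. 4.3, §6 Table 1] [cite: CreutzMiller2012, Thm. 1.1]
[cite: BurungaleFlach2024, Thm. 1.1 and Cor. 2] [cite: MilneADT2006, Thm. I.7.3] -/
theorem cornerFTwo_krizLiTwoFortyThreeIn_byName (hKL : KrizLi2019.thm112_bsdTwo_twist)
    (h33 : KrizLi2019.thm33_rank_twist) (hS31 : bsdTriple_of_analyticRank_le_one_of_conductor_lt)
    (hBF : bsdTriple_of_hasCM_of_L_one_ne_zero) (hmod : hasEntireLFunction_rat)
    (hGZK : rank_eq_analyticRank_of_analyticRank_le_one) (hCassels : bsdRHS_eq_of_isIsogenous)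
    (K : Type) [Field K] [NumberField K] (hK : IsImaginaryQuadratic K) (h3 : jacobiSym (NumberField.discr K) 3 = 1)
    (hSD : HasKrizLiStarDatum curve243a1 K) :
    ∀ (W : WeierstrassCurve ℚ) [W.IsElliptic] [W.IsGloballyMinimal], W.HasCM → W.analyticRank = 1 →
      CMInert W 2 → IsIsogenousToKrizLiTwoFortyThreeTwistIn K W → BSDp W 2 :=
  fun W _ _ _ _ _ hW =>
    bsdp_two_of_isIsogenousToKrizLiTwistOfSmallCMBase hKL h33 hS31 hBF hmod hGZK hCassels W
      (isIsogenousToKrizLiTwistOfSmallCMBase_of_twoFortyThreeIn K hK h3 hSD hW)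

end Summit.BirchSwinnertonDyer.Rank1Residual.P2

end
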